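import Summits.AtomisticToContinuum.BoseEinsteinCondensation.Theorems.BECThomsonPrincipleGDTransferBareAdmissibleOps

/-!
# Route `BECThomsonPrinciple`, crux `GDTransfer` (stmt-AtomisticToContinuum-9482), line `dyson-dressed-witness`:
# stub `stub_bareAdmissible` — a-priori bounds and zero-defect response of the bare LNSS pair

The registered stub `stub_bareAdmissible : Sig.stub_bareAdmissible` (`= LNSSAlgebra → BareAdmissibility`).
For an INTEGRABLE repulsive pair potential (`‖v‖₁ = ∫_{ℝ³} v(|x|)dx < ∞`) and every `(N, L) = (m+1, L)` there
is `R₀ = R₀(v, m, L)` such that for every mode `n ∈ ℤ³` and every periodic trial state `Ψ` the bare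
Lewin–Nam–Serfaty–Solovej pair `ζ₊ = Λ_n†Ψ`, `ζ₋ = Λ_nΨ` has `‖ζ±‖² ≤ R₀` and
`𝓔(ζ±) ≤ R₀(1 + ‖n‖²)(E(Ψ) + 1)`; moreover (W3) `‖ζ₊‖² + ‖ζ₋‖² ≤ 2N|σ_n(ζ₊, Ψ) + σ_n(Ψ, ζ₋)|` and (W4)
`n_n(Ψ) ≤ 2‖ζ₋‖²`.
* The bounds: parts 1–3 (`…BareAdmissible{Slot,Kinetic,Ops}`) control the budget `A𝓔 + B‖·‖²` through
  `P_i`, `Q_S`, `n̂₀^{-1/2}` and the plane-wave factors; here `Λ_n = n̂₀^{-1/2} Σ_i P_i e_{-n}(x_i)`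
  (`P_i^{(n)} = P_i ∘ e_{-n}(x_i)`, `fourierAvg_eq_cellAvg_phase`) and `Λ_n† = Σ_i e_n(x_i) P_i n̂₀^{-1/2}` are
  composed (`budget_lnssLower_le`, `budget_lnssUpper_le`), and the budget is read at `(A, B) = (0, 1)` (mass)
  and `(1, 1 + ‖n‖²)` (energy form) (`exists_apriori_const`).
* (W3), (W4) from the HYPOTHESIS `LNSSAlgebra`: (L2) at `g = Λ†Ψ` and `g = ΛΨ` gives
  `N(σ(Λ†Ψ, Ψ) + σ(Ψ, ΛΨ)) = ‖Λ†Ψ‖² + ‖ΛΨ‖² ≥ 0` (zero defect), and (L3) `‖ΛΨ‖² = n_n(Ψ)`.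
All [folklore] (KennedyLiebShastry1988; arXiv:1211.2778 §2–3; LSSY2005 App. A).
-/

noncomputable section

open MeasureTheory Filter
open scoped ENNReal NNReal ComplexConjugate

namespace Summit.AtomisticToContinuum.BoseEinsteinCondensation.Cruxes.GDTransfer.DysonDressedWitness

namespace Bare

open Literature.MathematicalPhysics.QuantumManyBody.BoseGas
open Summit.AtomisticToContinuum.BoseEinsteinCondensation.Theorems.GaussianDominationCan.Negative

variable {m : ℕ} {L : ℝ} {v : ℝ → ℝ≥0∞} {κ A B : ℝ≥0∞}

/-! ## The two LNSS operators -/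

/-- `P_i^{(p)} g = P_i (e_{-p}(x_i) g)`. [folklore] -/
theorem fourierAvg_eq_cellAvg_phase (p : Fin 3 → ℤ) (i : Fin (m + 1)) (g : Config (m + 1) → ℂ) :
    fourierAvg m L p i g = cellAvg (m + 1) L i (fun X => cellWave L (-p) (X i) * g X) := by
  rw [← Lnss.cellAvg_conj_cellWave_mul]
  simp only [conj_cellWave]

/-- `‖-p‖ = ‖p‖` for the real picture of a mode. [folklore] -/
theorem norm_neg_mode (p : Fin 3 → ℤ) : ‖(fun j => ((-p) j : ℝ))‖ = ‖(fun j => (p j : ℝ))‖ := by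
  have h : (fun j => (((-p) j : ℤ) : ℝ)) = -(fun j => (p j : ℝ)) := by
    funext j; simp
  rw [h, norm_neg]

/-- **Budget of `a_0†a_p = Σ_i P_i^{(p)}`**. [folklore] -/
theorem budget_sum_fourierAvg_le (hL : 0 < L) (hv : Measurable v)
    (hκ : ((m + 1 : ℕ) : ℝ≥0∞) ^ 2 * ((ENNReal.ofReal (L ^ 3))⁻¹ * ∫⁻ x : Space, v ‖x‖) ≤ κ)
    (hAB : A ≤ B) (p : Fin 3 → ℤ) (hq : A * ENNReal.ofReal (‖(fun j => (p j : ℝ))‖ ^ 2) ≤ B)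
    {g : Config (m + 1) → ℂ} (hg : ContDiff ℝ 1 g) :
    A * eform v L (fun X => ∑ i : Fin (m + 1), fourierAvg m L p i g X) +
        B * mass L (fun X => ∑ i : Fin (m + 1), fourierAvg m L p i g X) ≤
      2 ^ (m + 1) * (((m + 1 : ℕ) : ℝ≥0∞) * ((1 + κ) *
        ((2 + 6 * (((m + 1 : ℕ) : ℝ≥0∞) * ENNReal.ofReal ((2 * Real.pi / L) ^ 2))) *
          (A * eform v L g + B * mass L g)))) := by
  have hw : ContDiff ℝ 1 fun X : Config (m + 1) => g X := hg
  have hph : ∀ i : Fin (m + 1), ContDiff ℝ 1 fun X : Config (m + 1) => cellWave L (-p) (X i) * g X :=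
    fun i => (((contDiff_cellWave L (-p)).of_le (mod_cast le_top)).comp (contDiff_apply ℝ Space i)).mul hw
  have hq' : A * ENNReal.ofReal (‖(fun j => ((-p) j : ℝ))‖ ^ 2) ≤ B := by rwa [norm_neg_mode]
  calc A * eform v L (fun X => ∑ i : Fin (m + 1), fourierAvg m L p i g X) +
        B * mass L (fun X => ∑ i : Fin (m + 1), fourierAvg m L p i g X)
      ≤ 2 ^ (Finset.univ : Finset (Fin (m + 1))).card *
          ∑ i : Fin (m + 1), (A * eform v L (fourierAvg m L p i g) + B * mass L (fourierAvg m L p i g)) :=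
        budget_finset_sum_le hv Finset.univ fun i _ => Lnss.contDiff_fourierAvg p i hg
    _ ≤ 2 ^ (Finset.univ : Finset (Fin (m + 1))).card *
          ∑ _i : Fin (m + 1), ((1 + κ) *
            ((2 + 6 * (((m + 1 : ℕ) : ℝ≥0∞) * ENNReal.ofReal ((2 * Real.pi / L) ^ 2))) *
              (A * eform v L g + B * mass L g))) := by
        refine mul_le_mul' le_rfl (Finset.sum_le_sum fun i _ => ?_)
        rw [fourierAvg_eq_cellAvg_phase]
        exact (budget_cellAvg_le hL hv hκ hAB i (hph i)).trans
          (mul_le_mul' le_rfl (budget_phase_le hL hv (-p) i hq' hg))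
    _ = _ := by
        rw [Finset.sum_const, Finset.card_univ, Fintype.card_fin, nsmul_eq_mul]

/-- **Budget of `Λ_p = n̂₀^{-1/2} a_0†a_p`**. [folklore] -/
theorem budget_lnssLower_le (hL : 0 < L) (hv : Measurable v)
    (hκ : ((m + 1 : ℕ) : ℝ≥0∞) ^ 2 * ((ENNReal.ofReal (L ^ 3))⁻¹ * ∫⁻ x : Space, v ‖x‖) ≤ κ)
    (hAB : A ≤ B) (p : Fin 3 → ℤ) (hq : A * ENNReal.ofReal (‖(fun j => (p j : ℝ))‖ ^ 2) ≤ B)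
    {g : Config (m + 1) → ℂ} (hg : ContDiff ℝ 1 g) :
    A * eform v L (lnssLower m L p g) + B * mass L (lnssLower m L p g) ≤
      2 ^ (2 ^ (m + 1)) * (2 ^ (m + 1) * ((4 + 2 * κ) ^ (m + 1) *
        (2 ^ (m + 1) * (((m + 1 : ℕ) : ℝ≥0∞) * ((1 + κ) *
          ((2 + 6 * (((m + 1 : ℕ) : ℝ≥0∞) * ENNReal.ofReal ((2 * Real.pi / L) ^ 2))) *
            (A * eform v L g + B * mass L g))))))) := by
  have hs : ContDiff ℝ 1 fun X : Config (m + 1) => ∑ i : Fin (m + 1), fourierAvg m L p i g X :=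
    ContDiff.sum fun i _ => Lnss.contDiff_fourierAvg p i hg
  unfold lnssLower
  exact (budget_rootInv_le hL hv hκ hAB hs).trans (mul_le_mul' le_rfl (mul_le_mul' le_rfl
    (mul_le_mul' le_rfl (budget_sum_fourierAvg_le hL hv hκ hAB p hq hg))))

/-- **Budget of `Λ_p† = a_p†a_0 n̂₀^{-1/2}`**. [folklore] -/
theorem budget_lnssUpper_le (hL : 0 < L) (hv : Measurable v)
    (hκ : ((m + 1 : ℕ) : ℝ≥0∞) ^ 2 * ((ENNReal.ofReal (L ^ 3))⁻¹ * ∫⁻ x : Space, v ‖x‖) ≤ κ)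
    (hAB : A ≤ B) (p : Fin 3 → ℤ) (hq : A * ENNReal.ofReal (‖(fun j => (p j : ℝ))‖ ^ 2) ≤ B)
    {g : Config (m + 1) → ℂ} (hg : ContDiff ℝ 1 g) :
    A * eform v L (lnssUpper m L p g) + B * mass L (lnssUpper m L p g) ≤
      2 ^ (m + 1) * (((m + 1 : ℕ) : ℝ≥0∞) *
        ((2 + 6 * (((m + 1 : ℕ) : ℝ≥0∞) * ENNReal.ofReal ((2 * Real.pi / L) ^ 2))) * ((1 + κ) *
          (2 ^ (2 ^ (m + 1)) * (2 ^ (m + 1) * ((4 + 2 * κ) ^ (m + 1) *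
            (A * eform v L g + B * mass L g))))))) := by
  have hR : ContDiff ℝ 1 (rootInv m L g) := Lnss.contDiff_rootInv hg
  have hP : ∀ i : Fin (m + 1), ContDiff ℝ 1 (cellAvg (m + 1) L i (rootInv m L g)) := fun i =>
    Lnss.contDiff_cellAvg i hR
  have hterm : ∀ i : Fin (m + 1), ContDiff ℝ 1 fun X : Config (m + 1) =>
      cellWave L p (X i) * cellAvg (m + 1) L i (rootInv m L g) X := fun i =>
    (((contDiff_cellWave L p).of_le (mod_cast le_top)).comp (contDiff_apply ℝ Space i)).mul (hP i)
  unfold lnssUpper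
  calc A * eform v L (fun X => ∑ i : Fin (m + 1), cellWave L p (X i) *
          cellAvg (m + 1) L i (rootInv m L g) X) +
        B * mass L (fun X => ∑ i : Fin (m + 1), cellWave L p (X i) *
          cellAvg (m + 1) L i (rootInv m L g) X)
      ≤ 2 ^ (Finset.univ : Finset (Fin (m + 1))).card * ∑ i : Fin (m + 1),
          (A * eform v L (fun X => cellWave L p (X i) * cellAvg (m + 1) L i (rootInv m L g) X) +
            B * mass L (fun X => cellWave L p (X i) * cellAvg (m + 1) L i (rootInv m L g) X)) :=
        budget_finset_sum_le hv Finset.univ fun i _ => hterm i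
    _ ≤ 2 ^ (Finset.univ : Finset (Fin (m + 1))).card * ∑ _i : Fin (m + 1),
          ((2 + 6 * (((m + 1 : ℕ) : ℝ≥0∞) * ENNReal.ofReal ((2 * Real.pi / L) ^ 2))) * ((1 + κ) *
            (2 ^ (2 ^ (m + 1)) * (2 ^ (m + 1) * ((4 + 2 * κ) ^ (m + 1) *
              (A * eform v L g + B * mass L g)))))) := by
        refine mul_le_mul' le_rfl (Finset.sum_le_sum fun i _ => ?_)
        exact (budget_phase_le hL hv p i hq (hP i)).trans (mul_le_mul' le_rfl
          ((budget_cellAvg_le hL hv hκ hAB i hR).trans (mul_le_mul' le_rfl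
            (budget_rootInv_le hL hv hκ hAB hg))))
    _ = _ := by
        rw [Finset.sum_const, Finset.card_univ, Fintype.card_fin, nsmul_eq_mul]

/-! ## The a-priori constant -/

/-- **A-priori bounds of the bare pair**: for integrable `v` and `L > 0` there is a finite `C = C(v, m, L)`
with `‖Λ_p†g‖², ‖Λ_p g‖² ≤ C‖g‖²` and `𝓔(Λ_p†g), 𝓔(Λ_p g) ≤ C(𝓔(g) + (1 + ‖p‖²)‖g‖²)` for every mode `p`
and every `C¹` function `g`. [folklore] -/
theorem exists_apriori_const (hL : 0 < L) (hv : Measurable v) (hint : (∫⁻ x : Space, v ‖x‖) ≠ ⊤)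
    (m : ℕ) :
    ∃ C : ℝ≥0∞, C ≠ ⊤ ∧ ∀ (p : Fin 3 → ℤ) (g : Config (m + 1) → ℂ), ContDiff ℝ 1 g →
      mass L (lnssUpper m L p g) ≤ C * mass L g ∧ mass L (lnssLower m L p g) ≤ C * mass L g ∧
      eform v L (lnssUpper m L p g) ≤
        C * (eform v L g + (1 + ENNReal.ofReal (‖(fun j => (p j : ℝ))‖ ^ 2)) * mass L g) ∧
      eform v L (lnssLower m L p g) ≤
        C * (eform v L g + (1 + ENNReal.ofReal (‖(fun j => (p j : ℝ))‖ ^ 2)) * mass L g) := by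
  set κ : ℝ≥0∞ := ((m + 1 : ℕ) : ℝ≥0∞) ^ 2 * ((ENNReal.ofReal (L ^ 3))⁻¹ * ∫⁻ x : Space, v ‖x‖)
    with hκdef
  have hκ : ((m + 1 : ℕ) : ℝ≥0∞) ^ 2 * ((ENNReal.ofReal (L ^ 3))⁻¹ * ∫⁻ x : Space, v ‖x‖) ≤ κ :=
    le_rfl
  have hκtop : κ ≠ ⊤ := by
    refine ENNReal.mul_ne_top (ENNReal.pow_ne_top (ENNReal.natCast_ne_top _))
      (ENNReal.mul_ne_top (ENNReal.inv_ne_top.2 ?_) hint)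
    exact (ENNReal.ofReal_pos.2 (by positivity)).ne'
  set D : ℝ≥0∞ := 2 + 6 * (((m + 1 : ℕ) : ℝ≥0∞) * ENNReal.ofReal ((2 * Real.pi / L) ^ 2)) with hD
  have hDtop : D ≠ ⊤ :=
    ENNReal.add_ne_top.2 ⟨ENNReal.ofNat_ne_top, ENNReal.mul_ne_top ENNReal.ofNat_ne_top
      (ENNReal.mul_ne_top (ENNReal.natCast_ne_top _) ENNReal.ofReal_ne_top)⟩
  set R : ℝ≥0∞ := 2 ^ (2 ^ (m + 1)) * (2 ^ (m + 1) * (4 + 2 * κ) ^ (m + 1)) with hR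
  have h42 : 4 + 2 * κ ≠ ⊤ :=
    ENNReal.add_ne_top.2 ⟨ENNReal.ofNat_ne_top, ENNReal.mul_ne_top ENNReal.ofNat_ne_top hκtop⟩
  have hRtop : R ≠ ⊤ :=
    ENNReal.mul_ne_top (ENNReal.pow_ne_top ENNReal.ofNat_ne_top)
      (ENNReal.mul_ne_top (ENNReal.pow_ne_top ENNReal.ofNat_ne_top) (ENNReal.pow_ne_top h42))
  set C : ℝ≥0∞ := R * (2 ^ (m + 1) * (((m + 1 : ℕ) : ℝ≥0∞) * ((1 + κ) * D))) with hC
  have hCtop : C ≠ ⊤ :=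
    ENNReal.mul_ne_top hRtop (ENNReal.mul_ne_top (ENNReal.pow_ne_top ENNReal.ofNat_ne_top)
      (ENNReal.mul_ne_top (ENNReal.natCast_ne_top _)
        (ENNReal.mul_ne_top (ENNReal.add_ne_top.2 ⟨ENNReal.one_ne_top, hκtop⟩) hDtop)))
  refine ⟨C, hCtop, fun p g hg => ?_⟩
  set q : ℝ≥0∞ := ENNReal.ofReal (‖(fun j => (p j : ℝ))‖ ^ 2) with hq
  -- budgets at `(A, B) = (0, 1)` and `(1, 1 + q)`
  have h0q : (0 : ℝ≥0∞) * q ≤ 1 := by rw [zero_mul]; exact zero_le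
  have h1q : (1 : ℝ≥0∞) * q ≤ 1 + q := by rw [one_mul]; exact le_add_self
  have hU0 := budget_lnssUpper_le hL hv hκ (zero_le (a := (1 : ℝ≥0∞))) p h0q hg
  have hL0 := budget_lnssLower_le hL hv hκ (zero_le (a := (1 : ℝ≥0∞))) p h0q hg
  have hU1 := budget_lnssUpper_le hL hv hκ (le_self_add (a := (1 : ℝ≥0∞)) (b := q)) p h1q hg
  have hL1 := budget_lnssLower_le hL hv hκ (le_self_add (a := (1 : ℝ≥0∞)) (b := q)) p h1q hg
  simp only [zero_mul, zero_add, one_mul] at hU0 hL0 hU1 hL1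
  refine ⟨hU0.trans (le_of_eq ?_), hL0.trans (le_of_eq ?_),
    le_self_add.trans (hU1.trans (le_of_eq ?_)), le_self_add.trans (hL1.trans (le_of_eq ?_))⟩ <;>
    simp only [hC, hR, hD] <;> ring

end Bare

open Literature.MathematicalPhysics.QuantumManyBody.BoseGas in
/-- **Registered stub `stub_bareAdmissible`** (line `dyson-dressed-witness` of crux `GDTransfer`,
stmt-AtomisticToContinuum-9482): `LNSSAlgebra → BareAdmissibility` — for integrable `v`, at every `(N, L)` one
constant `R₀` bounds the masses of the bare pair `Λ_n†Ψ`, `Λ_nΨ` and, with the factor `(1 + ‖n‖²)(E(Ψ) + 1)`,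
their energy forms (`‖P_i h‖ ≤ ‖h‖`, `[∇_j, P_i] = 0`, Jensen for the interaction with `∫_cell v^per = ‖v‖₁`);
(W3) with zero defect and (W4) follow from (L2), (L3) of the hypothesis `LNSSAlgebra`. [folklore]
(KennedyLiebShastry1988; arXiv:1211.2778 §2–3; LSSY2005 App. A) -/
theorem stub_bareAdmissible : Sig.stub_bareAdmissible := by
  intro hLA v hv hint m L hL
  obtain ⟨C, hCtop, hC⟩ := Bare.exists_apriori_const (L := L) hL hv.1 hint m
  refine ⟨C.toReal + 1, by positivity, fun p Ψ => ?_⟩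
  obtain ⟨hdirL, hdirU, hpair, hmassL⟩ := hLA m L hL p Ψ
  obtain ⟨h1, h2, h3, h4⟩ := hC p Ψ.ψ Ψ.contDiff
  rw [mass_trialState Ψ, mul_one] at h1 h2 h3 h4
  rw [eform_trialState v Ψ] at h3 h4
  have hCle : C ≤ ENNReal.ofReal (C.toReal + 1) := by
    rw [ENNReal.ofReal_add ENNReal.toReal_nonneg zero_le_one, ENNReal.ofReal_toReal hCtop]
    exact le_self_add
  have hform : ∀ {e : ℝ≥0∞},
      e ≤ C * (periodicEnergy v Ψ + (1 + ENNReal.ofReal (‖(fun j => (p j : ℝ))‖ ^ 2))) →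
        e ≤ ENNReal.ofReal ((C.toReal + 1) * (1 + ‖(fun j => (p j : ℝ))‖ ^ 2)) *
          (periodicEnergy v Ψ + 1) := by
    intro e he
    refine he.trans ?_
    rw [ENNReal.ofReal_mul (by positivity), ENNReal.ofReal_add zero_le_one (sq_nonneg _),
      ENNReal.ofReal_one, mul_assoc]
    refine mul_le_mul' hCle ?_
    rw [mul_add, mul_one]
    refine add_le_add ?_ le_rfl
    calc periodicEnergy v Ψ = 1 * periodicEnergy v Ψ := (one_mul _).symm
      _ ≤ (1 + ENNReal.ofReal (‖(fun j => (p j : ℝ))‖ ^ 2)) * periodicEnergy v Ψ :=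
          mul_le_mul' le_self_add le_rfl
  refine ⟨h1.trans hCle, h2.trans hCle, hform h3, hform h4, ?_, ?_⟩
  · -- (W3): zero defect, from (L2) at `g = Λ†Ψ` and `g = ΛΨ`
    have hU := (hpair _ hdirU).1
    have hLo := (hpair _ hdirL).2
    rw [Lnss.integral_conj_mul_self] at hU hLo
    have hcU : Continuous (lnssUpper m L p Ψ.ψ) := hdirU.contDiff.continuous
    have hcL : Continuous (lnssLower m L p Ψ.ψ) := hdirL.contDiff.continuous
    have hIU : 0 ≤ ∫ X in cellN (m + 1) L, ‖lnssUpper m L p Ψ.ψ X‖ ^ 2 :=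
      integral_nonneg fun X => sq_nonneg _
    have hIL : 0 ≤ ∫ X in cellN (m + 1) L, ‖lnssLower m L p Ψ.ψ X‖ ^ 2 :=
      integral_nonneg fun X => sq_nonneg _
    have hsum : ((m + 1 : ℕ) : ℂ) *
        (srcPair m L p (lnssUpper m L p Ψ.ψ) Ψ.ψ + srcPair m L p Ψ.ψ (lnssLower m L p Ψ.ψ)) =
          (((∫ X in cellN (m + 1) L, ‖lnssUpper m L p Ψ.ψ X‖ ^ 2) +
            ∫ X in cellN (m + 1) L, ‖lnssLower m L p Ψ.ψ X‖ ^ 2 : ℝ) : ℂ) := by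
      rw [mul_add, hU, hLo]; push_cast; ring
    have hnorm : ((m + 1 : ℕ) : ℝ) *
        ‖srcPair m L p (lnssUpper m L p Ψ.ψ) Ψ.ψ + srcPair m L p Ψ.ψ (lnssLower m L p Ψ.ψ)‖ =
          (∫ X in cellN (m + 1) L, ‖lnssUpper m L p Ψ.ψ X‖ ^ 2) +
            ∫ X in cellN (m + 1) L, ‖lnssLower m L p Ψ.ψ X‖ ^ 2 := by
      have h := congrArg norm hsum
      rwa [norm_mul, Complex.norm_natCast, Complex.norm_real, Real.norm_of_nonneg (add_nonneg hIU hIL)]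
        at h
    unfold mass
    rw [Lnss.lintegral_nnnorm_sq_eq _ hcU, Lnss.lintegral_nnnorm_sq_eq _ hcL,
      ← ENNReal.ofReal_add hIU hIL, ← hnorm]
    exact le_add_self.trans_eq (two_mul _).symm
  · -- (W4): `n_n(Ψ) = ‖ΛΨ‖²` by (L3)
    rw [← hmassL]
    exact le_add_self.trans_eq (two_mul _).symm

end Summit.AtomisticToContinuum.BoseEinsteinCondensation.Cruxes.GDTransfer.DysonDressedWitness

end
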